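import Mathlib
import Literature.NumberTheory.Automorphic.HilbertModularFormQExpansion
import Summits.Langlands.Langlands.Theorems.CapacityClassicalityHilbertIntegralOverconvergentIsCongruenceStubFiniteQIndexAntidiagonal
import Summits.Langlands.Langlands.Theorems.CapacityClassicalityHilbertIntegralOverconvergentIsCongruenceStubSmulArgFourierCoeff

/-!
# Preliminaries for the supply from a seed form (§ U of line Sketch-ideate-r1-k1, lead part 2)

Part 2 of the lead's composition `stub_supplyFromSeed` (RESHAPE 17, § U) for the crux
`HilbertIntegralOverconvergentIsCongruence` (stmt-Langlands-8485): small facts about the cone `qIndexSet F` of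
`q`-expansion indices over a totally real field `F` and about monomial exponents.

* `ssp_gamma1_mono` — `𝔞 ≤ 𝔟 ⇒ Γ₁(𝔞) ≤ Γ₁(𝔟)`;
* `ssp_finite_cone_sublevel` — for a height `λ_y(ν) = ∑_σ y_σ σ(ν)` with `y ≫ 0`, the cone has finite sublevel sets
  `{ν ∈ cone : λ_y ν ≤ t}` (a sublevel set lies in a box, finite by the landed `fqa_box_finite`);
* `ssp_exists_height_min` — a non-zero cone-supported coefficient function attains its minimal height on its support;
* `ssp_div_mem_qIndexSet`, `ssp_mul_mem_qIndexSet` — the cone is stable under `ν ↦ δν` for totally positive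
  `δ ∈ 𝓞 F`, and `μ/δ` lies in the cone as soon as it lies in the dual lattice;
* `ssp_sym_sum_injective` — for `ω_0 = 0` and `ω_1, …, ω_n` linearly independent over `ℚ`, the monomial exponent
  `e ∈ Sym (Fin (n+1)) m` is determined by `∑_{l ∈ e} ω_l` (compare coordinates; the multiplicity of `0` is then fixed
  by the degree `m`).
-/

set_option linter.dupNamespace false

noncomputable section

namespace Summit.Langlands.Langlands.Theorems.HilbertIntegralOverconvergentIsCongruence

open MeasureTheory Complex NumberField
open Literature.NumberTheory.Automorphic Literature.NumberTheory.Automorphic.HilbertModular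
open scoped MatrixGroups

/-- `Γ₁` is monotone in the ideal: `𝔞 ≤ 𝔟 ⇒ Γ₁(𝔞) ≤ Γ₁(𝔟)`. -/
theorem ssp_gamma1_mono {R : Type*} [CommRing R] {𝔞 𝔟 : Ideal R} (h : 𝔞 ≤ 𝔟) :
    Bianchi.Gamma1 𝔞 ≤ Bianchi.Gamma1 𝔟 :=
  fun _ hγ ↦ ⟨h hγ.1, h hγ.2⟩

/-- **Finite sublevel sets of the cone.**  For `y ≫ 0` the set of cone indices `ν` with
`∑_σ y_σ σ(ν) ≤ t` is finite: each such `ν` is `0` or totally positive with `σ(ν) ≤ t / y_σ ≤ N`, so it lies in the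
box `0 ≤ σ(ν) ≤ σ(N)` of the dual lattice, which is finite (`fqa_box_finite`). -/
theorem ssp_finite_cone_sublevel {F : Type} [Field F] [NumberField F] [NumberField.IsTotallyReal F] (y : (F →+* ℝ) → ℝ) (hy : ∀ σ, 0 < y σ)
    (t : ℝ) : {ν : F | ν ∈ qIndexSet F ∧ ∑ σ : F →+* ℝ, y σ * σ ν ≤ t}.Finite := by
  classical
  -- a natural number bounding `t / y σ` for every `σ`
  obtain ⟨N, hN⟩ : ∃ N : ℕ, ∀ σ : F →+* ℝ, t / y σ ≤ N := by
    refine ⟨⌈∑ σ : F →+* ℝ, |t| / y σ⌉₊, fun σ ↦ ?_⟩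
    refine le_trans ?_ (Nat.le_ceil _)
    refine le_trans (div_le_div_of_nonneg_right (le_abs_self t) (hy σ).le) ?_
    exact Finset.single_le_sum (f := fun σ' : F →+* ℝ ↦ |t| / y σ')
      (fun σ' _ ↦ div_nonneg (abs_nonneg t) (hy σ').le) (Finset.mem_univ σ)
  refine (fqa_box_finite F (N : F)).subset ?_
  rintro ν ⟨hνc, hνt⟩
  obtain ⟨hνd, hν0⟩ := mem_qIndexSet_iff.mp hνc
  have hnonneg : ∀ σ : F →+* ℝ, 0 ≤ σ ν := fun σ ↦ by
    rcases hν0 with h | h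
    · rw [h, map_zero]
    · exact (h σ).le
  refine ⟨hνd, fun σ ↦ ⟨hnonneg σ, ?_⟩⟩
  rw [map_natCast]
  -- `y σ * σ ν ≤ ∑ = λ ν ≤ t`, so `σ ν ≤ t / y σ ≤ N`
  have h1 : y σ * σ ν ≤ t :=
    le_trans (Finset.single_le_sum (f := fun σ' : F →+* ℝ ↦ y σ' * σ' ν)
      (fun σ' _ ↦ mul_nonneg (hy σ').le (hnonneg σ')) (Finset.mem_univ σ)) hνt
  have h2 : σ ν ≤ t / y σ := by
    rw [le_div_iff₀ (hy σ), mul_comm]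
    exact h1
  exact h2.trans (hN σ)

/-- **A cone-supported coefficient function attains its minimal height on its support** (the support meets a
finite sublevel set of the cone). -/
theorem ssp_exists_height_min {F : Type} [Field F] [NumberField F] [NumberField.IsTotallyReal F] (y : (F →+* ℝ) → ℝ) (hy : ∀ σ, 0 < y σ)
    (a : F → ℂ) (ha : ∀ ν, a ν ≠ 0 → ν ∈ qIndexSet F) (ν₁ : F) (hν₁ : a ν₁ ≠ 0) :
    ∃ νs : F, a νs ≠ 0 ∧ ∀ ν, a ν ≠ 0 → ∑ σ : F →+* ℝ, y σ * σ νs ≤ ∑ σ : F →+* ℝ, y σ * σ ν := by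
  classical
  set T : Finset F := ((ssp_finite_cone_sublevel y hy (∑ σ : F →+* ℝ, y σ * σ ν₁)).toFinset).filter
    (fun ν ↦ a ν ≠ 0) with hT
  have hν₁T : ν₁ ∈ T := by
    rw [hT, Finset.mem_filter, Set.Finite.mem_toFinset]
    exact ⟨⟨ha ν₁ hν₁, le_rfl⟩, hν₁⟩
  obtain ⟨νs, hνsT, hmin⟩ := Finset.exists_min_image T (fun ν ↦ ∑ σ : F →+* ℝ, y σ * σ ν) ⟨ν₁, hν₁T⟩
  have hνs : a νs ≠ 0 := by
    rw [hT, Finset.mem_filter] at hνsT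
    exact hνsT.2
  refine ⟨νs, hνs, fun ν hν ↦ ?_⟩
  by_cases hle : ∑ σ : F →+* ℝ, y σ * σ ν ≤ ∑ σ : F →+* ℝ, y σ * σ ν₁
  · refine hmin ν ?_
    rw [hT, Finset.mem_filter, Set.Finite.mem_toFinset]
    exact ⟨⟨ha ν hν, hle⟩, hν⟩
  · exact ((hmin ν₁ hν₁T).trans (le_of_lt (not_le.mp hle)))

/-- If `μ` is a cone index and `μ/δ` (with `δ ∈ 𝓞 F` totally positive) lies in the dual lattice, then `μ/δ` is a
cone index. -/
theorem ssp_div_mem_qIndexSet {F : Type} [Field F] [NumberField F] (δ : 𝓞 F) (hδ : ∀ σ : F →+* ℝ, 0 < σ (δ : F)) {μ : F} (hμ : μ ∈ qIndexSet F)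
    (hdiv : ∀ a : 𝓞 F, ∃ n : ℤ, Algebra.trace ℚ F (μ / (δ : F) * a) = n) : μ / (δ : F) ∈ qIndexSet F := by
  refine mem_qIndexSet_iff.mpr ⟨hdiv, ?_⟩
  rcases (mem_qIndexSet_iff.mp hμ).2 with h | h
  · exact Or.inl (by rw [h, zero_div])
  · exact Or.inr fun σ ↦ by rw [map_div₀]; exact div_pos (h σ) (hδ σ)

/-- The cone is stable under multiplication by totally positive algebraic integers. -/
theorem ssp_mul_mem_qIndexSet {F : Type} [Field F] [NumberField F] (δ : 𝓞 F) (hδ : ∀ σ : F →+* ℝ, 0 < σ (δ : F)) {ν : F} (hν : ν ∈ qIndexSet F) :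
    (δ : F) * ν ∈ qIndexSet F := by
  obtain ⟨hνd, hν0⟩ := mem_qIndexSet_iff.mp hν
  refine mem_qIndexSet_iff.mpr ⟨fun a ↦ saf_mul_mem_dualLattice F δ hνd a, ?_⟩
  rcases hν0 with h | h
  · exact Or.inl (by rw [h, mul_zero])
  · exact Or.inr fun σ ↦ by rw [map_mul]; exact mul_pos (hδ σ) (h σ)

/-- Sums over a multiset of indices in `Fin (n+1)` as sums of multiplicities, with the `0`-th term dropped when
`ω 0 = 0`. -/
theorem ssp_multiset_sum_eq_count_smul {F : Type} [Field F] [NumberField F] {n : ℕ} (ω : Fin (n + 1) → F) (hω0 : ω 0 = 0)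
    (s : Multiset (Fin (n + 1))) :
    (s.map ω).sum = ∑ i : Fin n, ((s.count i.succ : ℕ) : ℚ) • ω i.succ := by
  classical
  rw [Finset.sum_multiset_map_count]
  rw [Finset.sum_subset (Finset.subset_univ s.toFinset) (fun x _ hx ↦ by
    rw [Multiset.count_eq_zero_of_notMem (fun h ↦ hx (Multiset.mem_toFinset.mpr h)), zero_smul])]
  rw [Fin.sum_univ_succ, hω0, smul_zero, zero_add]
  refine Finset.sum_congr rfl fun i _ ↦ ?_
  rw [Nat.cast_smul_eq_nsmul]

/-- The multiplicities of a multiset over `Fin (n+1)` add up to its cardinality, split off at `0`. -/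
theorem ssp_count_zero_add_sum_count_succ {n : ℕ} (s : Multiset (Fin (n + 1))) :
    s.count 0 + ∑ i : Fin n, s.count i.succ = Multiset.card s := by
  classical
  rw [← Fin.sum_univ_succ (f := fun l ↦ s.count l), ← Multiset.toFinset_sum_count_eq s]
  exact (Finset.sum_subset (Finset.subset_univ s.toFinset) (fun x _ hx ↦
    Multiset.count_eq_zero_of_notMem (fun h ↦ hx (Multiset.mem_toFinset.mpr h)))).symm

/-- **Monomial exponents are determined by their `ω`-moments.**  For `ω_0 = 0` and `ω_1, …, ω_n ∈ F` linearly
independent over `ℚ`, the map `e ↦ ∑_{l ∈ e} ω_l` is injective on the monomial exponents `Sym (Fin (n+1)) m` of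
each fixed degree `m` (the coordinates give the multiplicities of `1, …, n`, and the multiplicity of `0` is then
`m` minus their sum). -/
theorem ssp_sym_sum_injective {F : Type} [Field F] [NumberField F] {n : ℕ} (ω : Fin (n + 1) → F) (hω0 : ω 0 = 0)
    (hli : LinearIndependent ℚ (fun i : Fin n ↦ ω i.succ)) (m : ℕ) :
    Function.Injective (fun e : Sym (Fin (n + 1)) m ↦ ((e : Multiset (Fin (n + 1))).map ω).sum) := by
  classical
  intro e e' h
  simp only at h
  rw [ssp_multiset_sum_eq_count_smul ω hω0, ssp_multiset_sum_eq_count_smul ω hω0] at h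
  have hcount : ∀ i : Fin n,
      (e : Multiset (Fin (n + 1))).count i.succ = (e' : Multiset (Fin (n + 1))).count i.succ := by
    have h2 : ∑ i : Fin n, ((((e : Multiset (Fin (n + 1))).count i.succ : ℕ) : ℚ) -
        (((e' : Multiset (Fin (n + 1))).count i.succ : ℕ) : ℚ)) • ω i.succ = 0 := by
      simp only [sub_smul, Finset.sum_sub_distrib, h, sub_self]
    have h3 := Fintype.linearIndependent_iff.mp hli _ h2
    intro i
    exact_mod_cast sub_eq_zero.mp (h3 i)
  have hc := ssp_count_zero_add_sum_count_succ (e : Multiset (Fin (n + 1)))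
  have hc' := ssp_count_zero_add_sum_count_succ (e' : Multiset (Fin (n + 1)))
  rw [Sym.card_coe] at hc hc'
  have hsum : ∑ i : Fin n, (e : Multiset (Fin (n + 1))).count i.succ =
      ∑ i : Fin n, (e' : Multiset (Fin (n + 1))).count i.succ := Finset.sum_congr rfl fun i _ ↦ hcount i
  have hcount0 : (e : Multiset (Fin (n + 1))).count 0 = (e' : Multiset (Fin (n + 1))).count 0 := by omega
  apply Sym.coe_injective
  refine Multiset.ext.mpr fun l ↦ ?_
  exact Fin.cases hcount0 (fun i ↦ hcount i) l

end Summit.Langlands.Langlands.Theorems.HilbertIntegralOverconvergentIsCongruence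

end
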